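import Literature.Computability.QuantumComplexity.PolyCopies
import HarnessLib

/-!
# Polynomially many parallel INDEXED copies of a uniform quantum circuit family, I: the family and its product state

Topic `Literature/Computability/QuantumComplexity`; a variant of `PolyCopies.lean` (the
`K(n)`-copy family of Bennett–Bernstein–Brassard–Vazirani 1997, Thm. 4.13: "run `k` independent
copies of `M`") in which **copy `j` is told its index**: on inputs `x` of length `n`, block `j < K(n)`
receives the basis input `x ++ e_j`, where `e_j ∈ {0,1}^{K(n)}` is the `j`-th unit vector (one-hot
index), and runs the given family `F` at input length `n + K(n)`. This is the circuit-level form of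
*non-adaptive parallel subroutine calls on computed inputs* (Bennett–Bernstein–Brassard–Vazirani 1997,
§4, proof of Thm. 4.14: a polynomial number of calls to a `BQP` machine, here laid out in parallel;
Bernstein–Vazirani 1997, §8.2): composed with the classical wrap `CWrap.family`
(`CWrapAssembly.lean`) inside `F` (which may compute from `x ++ e_j` the `j`-th query) and around
the whole family (pre- and post-processing), it realises "for `j < K(|x|)`, run the quantum subroutine on
the `j`-th query, then post-process all answers classically" as ONE poly-time uniform family — the
infrastructure consumed by reductions that call a quantum *sampler* polynomially many times
(e.g. Regev 2009, Lemma 3.17, `GIVP ≤ DGS`: `n²` calls at each of `2n + 2` radii).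

Layout and proofs are those of `PolyCopies.lean`, adapted line by line: the copy now has input
length `nIn n = n + K(n)` (block width `b n = nIn n + pF(nIn n) + 2`), and stage 1 is the fan-out
of `x` into every block (`progFan`, CNOTs) followed by **one `NOT` per block** writing the one-hot
index (`progIdx`: `NOT` on wire `n + j` of block `j`). Proved here (Parts I–III): the layout and the
programs, stage 1 on the input (`w1`; `w1_blk_idx`: wire `n + j'` of block `j` holds `[j' = j]`),
the circuits and the family, oracle-freeness, **the product state after the quantum stage**
(`stageQ_mulVec_W1`, now with block-dependent block states `blockState x j`), the output kernel as
the Born sum of that product state (`kernelProb_family_eq`), and the normalisation of the block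
states. Part IV (uniformity) is `PolyCopiesIdxUniform.lean`; the output LAW (the block outputs are
independent with laws `F.kernel (x ++ e_j)`) is `PolyCopiesIdxLaw.lean`.

## References

* C. H. Bennett, E. Bernstein, G. Brassard, U. Vazirani, *Strengths and weaknesses of quantum
  computing*, SIAM J. Comput. 26 (1997) 1510–1523, Thm. 4.13 and Thm. 4.14 (proofs; arXiv:quant-ph/9701001,
  pp. 12–13) [BennettBernsteinBrassardVazirani1997].
* E. Bernstein, U. Vazirani, *Quantum complexity theory*, SIAM J. Comput. 26 (1997), §8.2
  [BernsteinVazirani1997].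
* M. A. Nielsen, I. L. Chuang, *Quantum Computation and Quantum Information*, CUP 2010, §1.3.4
  (swap from three `CNOT`s), §2.1.7 eq. (2.45), §2.2.8, §4.3 [NielsenChuang2010].
* S. Arora, B. Barak, *Computational Complexity: A Modern Approach*, CUP 2009, §10.3.7 Lemma 10.10
  [AroraBarak2009].
-/

noncomputable section

namespace Literature.Computability.QuantumComplexity

namespace PolyCopiesIdx

open _root_.Computability Complexity Cryptography RevSim RevMux Function Matrix Finset

/-! ## Part I. Layout and the fan-out program -/

variable (P : PolyCopies.Params)

/-! ### Layout -/

/-- The number of copies on inputs of length `n`: `pK(n) + 1 ≥ 1`. [folklore] -/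
def K (n : ℕ) : ℕ := P.pK.eval n + 1

/-- **The input length of the copies**: `n` data bits and `K(n)` index bits (one-hot). [folklore] -/
def nIn (n : ℕ) : ℕ := n + K P n

/-- The block width (= the width of the front window): `nIn n + pF (nIn n) + 2`. [folklore] -/
def b (n : ℕ) : ℕ := nIn P n + P.pF.eval (nIn P n) + 2

/-- The first wire of the blocks (one idle wire after the front window). [folklore] -/
def base (n : ℕ) : ℕ := b P n + 1

/-- Wire `i` of block `j`. [folklore] -/
def blk (n j i : ℕ) : ℕ := base P n + j * b P n + i

/-- The total number of wires. [folklore] -/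
def W (n : ℕ) : ℕ := base P n + K P n * b P n

/-- The number of ancillas. [folklore] -/
def anc (n : ℕ) : ℕ := W P n - n

/-! ### Size bookkeeping -/

section Sizes

variable {P}

/-- `0 < K n`. [folklore] -/
theorem K_pos (n : ℕ) : 0 < K P n := Nat.succ_pos _

/-- `n ≤ nIn n`. [folklore] -/
theorem le_nIn (n : ℕ) : n ≤ nIn P n := Nat.le_add_right _ _

/-- `n + j < nIn n` for `j < K n` (the index wires are input wires of the copy). [folklore] -/
theorem add_lt_nIn {n j : ℕ} (hj : j < K P n) : n + j < nIn P n := by unfold nIn; omega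

/-- `2 ≤ b n`. [folklore] -/
theorem two_le_b (n : ℕ) : 2 ≤ b P n := by unfold b; omega

/-- `nIn n + 2 ≤ b n`. [folklore] -/
theorem nIn_add_two_le_b (n : ℕ) : nIn P n + 2 ≤ b P n := by unfold b; omega

/-- `0 < b n`. [folklore] -/
theorem b_pos (n : ℕ) : 0 < b P n := lt_of_lt_of_le Nat.zero_lt_two (two_le_b n)

/-- `n + 2 ≤ b n`. [folklore] -/
theorem add_two_le_b (n : ℕ) : n + 2 ≤ b P n := by have := le_nIn (P := P) n; unfold b; omega

/-- The copy fits into a block: `nIn n + F.ancillas (nIn n) ≤ b n`. [folklore] -/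
theorem copy_fits (n : ℕ) : nIn P n + P.F.ancillas (nIn P n) ≤ b P n := by
  have := P.hpF (nIn P n); unfold b; omega

/-- The index wires fit into a block: `nIn n ≤ b n`. [folklore] -/
theorem nIn_le_b (n : ℕ) : nIn P n ≤ b P n := by unfold b; omega

/-- `b n < base n`. [folklore] -/
theorem b_lt_base (n : ℕ) : b P n < base P n := by unfold base; omega

/-- `base n ≤ W n`. [folklore] -/
theorem base_le_W (n : ℕ) : base P n ≤ W P n := by unfold W; exact Nat.le_add_right _ _

/-- `blk n 0 0 = base n`. [folklore] -/
theorem blk_zero_zero (n : ℕ) : blk P n 0 0 = base P n := by unfold blk; simp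

/-- `blk n j i = blk n j 0 + i`. [folklore] -/
theorem blk_eq_add (n j i : ℕ) : blk P n j i = blk P n j 0 + i := by unfold blk; omega

/-- Wires of block `j < K n` are below `W`. [folklore] -/
theorem blk_lt_W {n j i : ℕ} (hj : j < K P n) (hi : i < b P n) : blk P n j i < W P n := by
  unfold blk W
  have : j * b P n + i < K P n * b P n := by
    calc j * b P n + i < j * b P n + b P n := by omega
      _ = (j + 1) * b P n := by ring
      _ ≤ K P n * b P n := Nat.mul_le_mul_right _ hj
  omega

/-- Blocks are disjoint: equal wires have equal block and offset. [folklore] -/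
theorem blk_inj {n j i j' i' : ℕ} (hi : i < b P n) (hi' : i' < b P n) (h : blk P n j i = blk P n j' i') :
    j = j' ∧ i = i' := by
  unfold blk at h
  have h1 : j * b P n + i = j' * b P n + i' := by omega
  have hj : j = j' := by nlinarith
  subst hj
  exact ⟨rfl, by omega⟩

/-- `base ≤ blk`. [folklore] -/
theorem base_le_blk (n j i : ℕ) : base P n ≤ blk P n j i := by unfold blk; omega

/-- `n ≤ W n`. [folklore] -/
theorem le_W (n : ℕ) : n ≤ W P n :=
  ((Nat.le_add_right n 2).trans (add_two_le_b n)).trans ((b_lt_base n).le.trans (base_le_W n))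

/-- **`n + anc n = W n`.** [folklore] -/
theorem n_add_anc (n : ℕ) : n + anc P n = W P n := by have := le_W (P := P) n; unfold anc; omega

/-- There is a wire. [folklore] -/
theorem width_pos (n : ℕ) : 0 < n + anc P n := by
  rw [n_add_anc]; exact lt_of_lt_of_le (lt_of_lt_of_le (by norm_num) (two_le_b n)) ((b_lt_base n).le.trans (base_le_W n))

/-- `base < W` (there is a block). [folklore] -/
theorem base_lt_W (n : ℕ) : base P n < W P n := by
  have h := blk_lt_W (P := P) (n := n) (j := 0) (i := 0) (K_pos n) (b_pos n)
  rwa [blk_zero_zero] at h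

end Sizes

/-! ### The programs -/

/-- **Stage 1a: fan-out of the input** into the data wires of every block ("write out `k` copies
of the input", BBBV step 2). [cite: BennettBernsteinBrassardVazirani1997, Thm. 4.13 (proof, step 2)] -/
def progFan (n : ℕ) : List (ClOp ℕ) :=
  (List.range (K P n)).flatMap fun j => (List.range n).map fun i => ClOp.cnot i (blk P n j i)

/-- The index wires: wire `n + j` of block `j`, `j < K n`. [folklore] -/
def idxWires (n : ℕ) : List ℕ := (List.range (K P n)).map fun j => blk P n j (n + j)

/-- **Stage 1b: the one-hot indices** — one `NOT` on wire `n + j` of block `j`, so that block `j`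
holds the basis input `x ++ e_j` of the `j`-th subroutine call (BBBV 1997, proof of Thm. 4.14: the
inputs of the successive calls are computed classically; here they differ only in the index).
[cite: BennettBernsteinBrassardVazirani1997, Thm. 4.14 (proof)] -/
def progIdx (n : ℕ) : List (ClOp ℕ) := (idxWires P n).map ClOp.not

/-- **Stage 1**: fan-out, then indices. [cite: BennettBernsteinBrassardVazirani1997, Thm. 4.13–4.14 (proofs)] -/
def prog1 (n : ℕ) : List (ClOp ℕ) := progFan P n ++ progIdx P n

/-- The pairs (front wire `i`, wire `i` of block `j`), `i < b n`. [folklore] -/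
def conjPairs (n j : ℕ) : List (ℕ × ℕ) := (List.range (b P n)).map fun i => (i, blk P n j i)

/-- **The conjugating swap of block `j` with the front window.** [cite: NielsenChuang2010, §1.3.4 (swap from three CNOTs)] -/
def progConj (n j : ℕ) : List (ClOp ℕ) := swapOps (conjPairs P n j)

/-! ### Well-formedness and wire bounds -/

section WF

variable {P}

/-- Membership in `progFan`. [folklore] -/
theorem mem_progFan {n : ℕ} {op : ClOp ℕ} : op ∈ progFan P n ↔ ∃ j < K P n, ∃ i < n, op = ClOp.cnot i (blk P n j i) := by
  simp only [progFan, List.mem_flatMap, List.mem_range, List.mem_map]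
  constructor
  · rintro ⟨j, hj, i, hi, rfl⟩; exact ⟨j, hj, i, hi, rfl⟩
  · rintro ⟨j, hj, i, hi, rfl⟩; exact ⟨j, hj, i, hi, rfl⟩

/-- `progFan` is well formed. [folklore] -/
theorem progFan_wf (n : ℕ) : ∀ op ∈ progFan P n, op.WF := by
  intro op hop
  obtain ⟨j, -, i, hi, rfl⟩ := mem_progFan.1 hop
  have : i < base P n := lt_of_lt_of_le hi ((Nat.le_add_right n 2).trans ((add_two_le_b n).trans (b_lt_base n).le))
  exact Nat.ne_of_lt (lt_of_lt_of_le this (base_le_blk n j i))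

/-- Membership in `idxWires`. [folklore] -/
theorem mem_idxWires {n p : ℕ} : p ∈ idxWires P n ↔ ∃ j < K P n, p = blk P n j (n + j) := by
  simp only [idxWires, List.mem_map, List.mem_range]
  constructor
  · rintro ⟨j, hj, rfl⟩; exact ⟨j, hj, rfl⟩
  · rintro ⟨j, hj, rfl⟩; exact ⟨j, hj, rfl⟩

/-- `idxWires` has no duplicates (distinct blocks). [folklore] -/
theorem nodup_idxWires (n : ℕ) : (idxWires P n).Nodup := by
  unfold idxWires
  refine List.nodup_range.map_on fun j hj j' hj' h => ?_
  rw [List.mem_range] at hj hj'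
  exact (blk_inj ((add_lt_nIn hj).trans_le (nIn_le_b n)) ((add_lt_nIn hj').trans_le (nIn_le_b n)) h).1

/-- `progIdx` is well formed. [folklore] -/
theorem progIdx_wf (n : ℕ) : ∀ op ∈ progIdx P n, op.WF := by
  intro op hop
  obtain ⟨p, -, rfl⟩ := List.mem_map.1 hop
  trivial

/-- `prog1` is well formed. [folklore] -/
theorem prog1_wf (n : ℕ) : ∀ op ∈ prog1 P n, op.WF := fun op hop =>
  (List.mem_append.1 hop).elim (progFan_wf n op) (progIdx_wf n op)

/-- `progConj` is well formed. [folklore] -/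
theorem progConj_wf (n j : ℕ) : ∀ op ∈ progConj P n j, op.WF := by
  refine swapOps_wf fun p hp => ?_
  simp only [conjPairs, List.mem_map, List.mem_range] at hp
  obtain ⟨i, hi, rfl⟩ := hp
  exact Nat.ne_of_lt (lt_of_lt_of_le hi ((b_lt_base n).le.trans (base_le_blk n j i)))

/-- `progFan` uses wires below `W`. [folklore] -/
theorem progFan_lt (n : ℕ) : ∀ op ∈ progFan P n, ∀ p ∈ wiresOf op, p < W P n := by
  intro op hop p hp
  obtain ⟨j, hj, i, hi, rfl⟩ := mem_progFan.1 hop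
  simp only [mem_wiresOf, ClOp.target, ClOp.controls, List.mem_singleton] at hp
  rcases hp with rfl | rfl
  · exact blk_lt_W hj (lt_of_lt_of_le hi ((Nat.le_add_right n 2).trans (add_two_le_b n)))
  · exact lt_of_lt_of_le hi (le_W n)

/-- `progIdx` uses wires below `W`. [folklore] -/
theorem progIdx_lt (n : ℕ) : ∀ op ∈ progIdx P n, ∀ p ∈ wiresOf op, p < W P n := by
  intro op hop p hp
  obtain ⟨q, hq, rfl⟩ := List.mem_map.1 hop
  obtain ⟨j, hj, rfl⟩ := mem_idxWires.1 hq
  simp only [mem_wiresOf, ClOp.target, ClOp.controls, List.not_mem_nil, or_false] at hp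
  subst hp
  exact blk_lt_W hj ((add_lt_nIn hj).trans_le (nIn_le_b n))

/-- `prog1` uses wires below `W`. [folklore] -/
theorem prog1_lt (n : ℕ) : ∀ op ∈ prog1 P n, ∀ p ∈ wiresOf op, p < W P n := fun op hop =>
  (List.mem_append.1 hop).elim (progFan_lt n op) (progIdx_lt n op)

/-- `progConj n j`, `j < K n`, uses wires below `W`. [folklore] -/
theorem progConj_lt {n j : ℕ} (hj : j < K P n) : ∀ op ∈ progConj P n j, ∀ p ∈ wiresOf op, p < W P n := by
  intro op hop p hp
  obtain ⟨q, hq, h⟩ := CWrap.wiresOf_swapOps hop p hp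
  simp only [conjPairs, List.mem_map, List.mem_range] at hq
  obtain ⟨i, hi, rfl⟩ := hq
  rcases h with rfl | rfl
  · exact lt_of_lt_of_le hi ((b_lt_base n).le.trans (base_le_W n))
  · exact blk_lt_W hj hi

end WF

/-! ### Semantics of stage 1 -/

section Stage1

/-- The assignment after the fan-out `progFan` on the input `x`. [folklore] -/
def wFan (x : List Bool) : ℕ → Bool := clEval (progFan P x.length) (PostBQPAmp.inp x)

/-- **The assignment after stage 1** on the input `x` (`PostBQPAmp.inp x`: `x` followed by zeros).
[folklore] -/
def w1 (x : List Bool) : ℕ → Bool := clEval (prog1 P x.length) (PostBQPAmp.inp x)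

variable {P}

/-- Stage 1 is the fan-out followed by the index `NOT`s. [folklore] -/
theorem w1_eq (x : List Bool) : w1 P x = clEval (progIdx P x.length) (wFan P x) := by
  unfold w1 prog1 wFan; rw [clEval_append]

/-- **The index `NOT`s flip exactly the index wires.** [folklore] -/
theorem clEval_progIdx_apply (n : ℕ) (w : ℕ → Bool) (p : ℕ) :
    clEval (progIdx P n) w p = (if p ∈ idxWires P n then !w p else w p) := by
  unfold progIdx
  split_ifs with hp
  · exact clEval_map_not_of_mem _ (nodup_idxWires n) w hp
  · exact clEval_map_not_of_not_mem _ w hp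

/-- Targets of `progFan` are never controls of `progFan`. [folklore] -/
theorem progFan_disjoint (n : ℕ) : ∀ op ∈ progFan P n, ∀ op' ∈ progFan P n, op'.target ∉ op.controls := by
  intro op hop op' hop'
  obtain ⟨j, -, i, hi, rfl⟩ := mem_progFan.1 hop
  obtain ⟨j', -, i', -, rfl⟩ := mem_progFan.1 hop'
  simp only [ClOp.target, ClOp.controls, List.mem_singleton]
  intro h
  have h1 := base_le_blk (P := P) n j' i'
  have h2 : i < base P n := lt_of_lt_of_le hi ((Nat.le_add_right n 2).trans ((add_two_le_b n).trans (b_lt_base n).le))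
  omega

/-- `progFan` does not touch wires that are not block data wires. [folklore] -/
theorem clEval_progFan_of_ne (n : ℕ) (w : ℕ → Bool) {p : ℕ} (hp : ∀ j < K P n, ∀ i < n, p ≠ blk P n j i) :
    clEval (progFan P n) w p = w p :=
  clEval_apply_of_forall_target_ne _ _ fun op hop e => by
    obtain ⟨j, hj, i, hi, rfl⟩ := mem_progFan.1 hop
    exact hp j hj i hi e.symm

/-- `progFan` does not touch wires below `base`. [folklore] -/
theorem clEval_progFan_of_lt_base (n : ℕ) (w : ℕ → Bool) {p : ℕ} (hp : p < base P n) : clEval (progFan P n) w p = w p :=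
  clEval_progFan_of_ne n w fun j _ i _ e => absurd (base_le_blk (P := P) n j i) (by rw [← e]; exact Nat.not_le.2 hp)

/-- **`progFan` XORs input wire `i` into wire `i` of every block.** [cite: NielsenChuang2010, §1.3.4 (CNOT copies classical bits)] -/
theorem clEval_progFan_blk (n : ℕ) (w : ℕ → Bool) {j i : ℕ} (hj : j < K P n) (hi : i < n) :
    clEval (progFan P n) w (blk P n j i) = (w (blk P n j i) ^^ w i) := by
  have hib : ∀ i, i < n → i < b P n := fun i hi => lt_of_lt_of_le hi ((Nat.le_add_right n 2).trans (add_two_le_b n))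
  rw [clEval_apply_of_disjoint _ (progFan_disjoint n)]
  congr 1
  unfold progFan
  rw [clToggle_flatMap_of_forall_ne (List.range (K P n)) _ w (blk P n j i) j List.nodup_range (List.mem_range.2 hj) ?_]
  · have hmem : ClOp.cnot i (blk P n j i) ∈ (List.range n).map fun i => ClOp.cnot i (blk P n j i) :=
      List.mem_map.2 ⟨i, List.mem_range.2 hi, rfl⟩
    have h := clToggle_eq_guard_of_nodup ((List.range n).map fun i => ClOp.cnot i (blk P n j i)) w ?_ hmem
    · simpa [ClOp.target, ClOp.guard] using h
    · rw [List.map_map]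
      exact List.nodup_range.map_on fun a _ c _ h => by
        simp only [Function.comp_apply, ClOp.target] at h
        unfold blk at h; omega
  · intro j' _ hne op hop
    obtain ⟨i', hi', rfl⟩ := List.mem_map.1 hop
    simp only [ClOp.target]
    intro e
    exact hne (blk_inj (hib i' (List.mem_range.1 hi')) (hib i hi) e).1

/-- An index wire is not below `base`. [folklore] -/
theorem not_mem_idxWires_of_lt_base {n p : ℕ} (hp : p < base P n) : p ∉ idxWires P n := fun h => by
  obtain ⟨j, -, rfl⟩ := mem_idxWires.1 h
  exact absurd (base_le_blk (P := P) n j (n + j)) (Nat.not_le.2 hp)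

/-- A block wire `blk j i` is an index wire iff `i = n + j` (for `i < b n`, `j < K n`). [folklore] -/
theorem blk_mem_idxWires_iff {n j i : ℕ} (hj : j < K P n) (hi : i < b P n) :
    blk P n j i ∈ idxWires P n ↔ i = n + j := by
  rw [mem_idxWires]
  constructor
  · rintro ⟨j', hj', e⟩
    obtain ⟨rfl, rfl⟩ := blk_inj hi ((add_lt_nIn hj').trans_le (nIn_le_b n)) e
    rfl
  · rintro rfl; exact ⟨j, hj, rfl⟩

/-- Below `base`, stage 1 keeps the input: `x` followed by zeros. [folklore] -/
theorem w1_of_lt_base (x : List Bool) {p : ℕ} (hp : p < base P x.length) : w1 P x p = PostBQPAmp.inp x p := by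
  rw [w1_eq, clEval_progIdx_apply, if_neg (not_mem_idxWires_of_lt_base hp)]
  exact clEval_progFan_of_lt_base _ _ hp

/-- Data wires keep `x`. [folklore] -/
theorem w1_of_lt (x : List Bool) {p : ℕ} (hp : p < x.length) : w1 P x p = x.getD p false :=
  w1_of_lt_base x (lt_of_lt_of_le hp (((Nat.le_add_right _ 2).trans (add_two_le_b _)).trans (b_lt_base _).le))

/-- Wires in `[|x|, base)` are `0` after stage 1. [folklore] -/
theorem w1_of_le_of_lt_base (x : List Bool) {p : ℕ} (hp : x.length ≤ p) (hp' : p < base P x.length) : w1 P x p = false := by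
  rw [w1_of_lt_base x hp']; exact PostBQPAmp.inp_of_le x hp

/-- After the fan-out, the data wires of every block hold `x`. [cite: NielsenChuang2010, §1.3.4 (CNOT copies classical bits)] -/
theorem wFan_blk_of_lt (x : List Bool) {j i : ℕ} (hj : j < K P x.length) (hi : i < x.length) :
    wFan P x (blk P x.length j i) = x.getD i false := by
  unfold wFan
  rw [clEval_progFan_blk _ _ hj hi, PostBQPAmp.inp_of_le x ((((Nat.le_add_right _ 2).trans (add_two_le_b _)).trans (b_lt_base _).le).trans
    (base_le_blk _ j i)), Bool.false_xor]
  rfl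

/-- After the fan-out, the other wires of every block are `0`. [folklore] -/
theorem wFan_blk_of_le (x : List Bool) {j i : ℕ} (hi : x.length ≤ i) (hib : i < b P x.length) :
    wFan P x (blk P x.length j i) = false := by
  unfold wFan
  rw [clEval_progFan_of_ne _ _ (fun j' _ i' hi' e => ?_)]
  · exact PostBQPAmp.inp_of_le x ((((Nat.le_add_right _ 2).trans (add_two_le_b _)).trans (b_lt_base _).le).trans (base_le_blk _ j i))
  · have := (blk_inj hib (lt_of_lt_of_le hi' (((Nat.le_add_right _ 2).trans (add_two_le_b _)))) e).2
    omega

/-- **The data wires of every block hold `x`.** [cite: NielsenChuang2010, §1.3.4 (CNOT copies classical bits)] -/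
theorem w1_blk_of_lt (x : List Bool) {j i : ℕ} (hj : j < K P x.length) (hi : i < x.length) :
    w1 P x (blk P x.length j i) = x.getD i false := by
  have hib : i < b P x.length := lt_of_lt_of_le hi ((Nat.le_add_right _ 2).trans (add_two_le_b _))
  rw [w1_eq, clEval_progIdx_apply, if_neg (fun h => ?_), wFan_blk_of_lt x hj hi]
  have := (blk_mem_idxWires_iff hj hib).1 h
  omega

/-- **The index wires of block `j` hold the one-hot vector `e_j`**: wire `|x| + j'` of block `j`
reads `[j' = j]`. [cite: BennettBernsteinBrassardVazirani1997, Thm. 4.14 (proof: inputs of the calls)] -/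
theorem w1_blk_idx (x : List Bool) {j j' : ℕ} (hj : j < K P x.length) (hj' : j' < K P x.length) :
    w1 P x (blk P x.length j (x.length + j')) = decide (j' = j) := by
  have hib : x.length + j' < b P x.length := (add_lt_nIn hj').trans_le (nIn_le_b _)
  rw [w1_eq, clEval_progIdx_apply, wFan_blk_of_le x (Nat.le_add_right _ _) hib]
  by_cases h : j' = j
  · subst h; rw [if_pos ((blk_mem_idxWires_iff hj hib).2 rfl)]; simp
  · rw [if_neg (fun hm => h ?_)]
    · simp [h]
    · have := (blk_mem_idxWires_iff hj hib).1 hm; omega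

/-- The wires of every block from `nIn` on are `0`. [folklore] -/
theorem w1_blk_of_le (x : List Bool) {j i : ℕ} (hj : j < K P x.length) (hi : nIn P x.length ≤ i) (hib : i < b P x.length) :
    w1 P x (blk P x.length j i) = false := by
  rw [w1_eq, clEval_progIdx_apply, if_neg (fun h => ?_), wFan_blk_of_le x ((le_nIn _).trans hi) hib]
  have := (blk_mem_idxWires_iff hj hib).1 h
  unfold nIn at hi; omega

/-- Everything from `W` on is `0` after stage 1. [folklore] -/
theorem w1_of_W_le (x : List Bool) {p : ℕ} (hp : W P x.length ≤ p) : w1 P x p = false := by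
  rw [w1_eq, clEval_progIdx_apply, if_neg (fun h => ?_)]
  · unfold wFan
    rw [clEval_progFan_of_ne _ _ (fun j hj i hi e => ?_)]
    · exact PostBQPAmp.inp_of_le x ((le_W _).trans hp)
    · have := blk_lt_W (P := P) hj (lt_of_lt_of_le hi ((Nat.le_add_right _ 2).trans (add_two_le_b _)))
      omega
  · obtain ⟨j, hj, rfl⟩ := mem_idxWires.1 h
    have := blk_lt_W (P := P) hj ((add_lt_nIn hj).trans_le (nIn_le_b _))
    omega

end Stage1

/-! ## Part II. The circuits, the family, and the matrices of the stages -/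

section Compile

variable {P}

/-- `prog1` fits. [folklore] -/
theorem prog1_lt' (n : ℕ) : ∀ op ∈ prog1 P n, ∀ i ∈ wiresOf op, i < n + anc P n := by
  rw [n_add_anc]; exact prog1_lt n

/-- `progConj n j` fits (for `j < K n`). [folklore] -/
theorem progConj_lt' {n j : ℕ} (hj : j < K P n) : ∀ op ∈ progConj P n j, ∀ i ∈ wiresOf op, i < n + anc P n := by
  rw [n_add_anc]; exact progConj_lt hj

/-- The copy fits into the register. [folklore] -/
theorem copy_fits' (n : ℕ) : nIn P n + P.F.ancillas (nIn P n) ≤ n + anc P n := by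
  rw [n_add_anc]; exact (copy_fits n).trans ((b_lt_base n).le.trans (base_le_W n))

/-- The front window fits into the register. [folklore] -/
theorem b_fits (n : ℕ) : b P n ≤ n + anc P n := by
  rw [n_add_anc]; exact (b_lt_base n).le.trans (base_le_W n)

variable (P)

/-- A program over `ℕ` with wires below `n + anc n`, re-indexed to `Fin (n + anc n)` and turned into
reversible operations. [cite: AroraBarak2009, §10.3.7 Lemma 10.10] -/
def clamp (n : ℕ) (ops : List (ClOp ℕ)) (hlt : ∀ op ∈ ops, ∀ i ∈ wiresOf op, i < n + anc P n)
    (hwf : ∀ op ∈ ops, op.WF) : List (RevOp (n + anc P n)) :=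
  toRevList (ops.map (ClOp.map (finOf (n + anc P n) (width_pos n)))) fun op hop => by
    simp only [List.mem_map] at hop
    obtain ⟨op, hop, rfl⟩ := hop
    exact wf_map_finOf _ (hlt op hop) (hwf op hop)

/-- **Semantics of a clamped program**: the `ℕ`-program on the lifted assignment. [folklore] -/
theorem revEval_clamp (n : ℕ) (ops : List (ClOp ℕ)) (hlt : ∀ op ∈ ops, ∀ i ∈ wiresOf op, i < n + anc P n)
    (hwf : ∀ op ∈ ops, op.WF) (w : QReg (n + anc P n)) (p : Fin (n + anc P n)) :
    revEval (clamp P n ops hlt hwf) w p = clEval ops (liftW w) p := by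
  unfold clamp
  rw [revEval_toRevList, clEval_map_finOf_apply _ ops hlt]

/-- Stage 1, compiled. [folklore] -/
def stage1 (n : ℕ) : List (QGate cliffordT (n + anc P n)) :=
  revCompile (clamp P n (prog1 P n) (prog1_lt' n) (prog1_wf n))

/-- **The conjugating swap of block `j`**, compiled (empty for `j ≥ K n`). [cite: NielsenChuang2010, §1.3.4 (swap from three CNOTs)] -/
def conjGates (n j : ℕ) : List (QGate cliffordT (n + anc P n)) :=
  if h : j < K P n then revCompile (clamp P n (progConj P n j) (progConj_lt' h) (progConj_wf n j)) else []

/-- **The copy**: `F.circ (nIn n)` on the front wires, verbatim. [cite: AroraBarak2009, §6.2 (a circuit for each input length, hard-wired)] -/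
def copyGates (n : ℕ) : List (QGate cliffordT (n + anc P n)) :=
  (mapWires (Fin.castLEEmb (copy_fits' n)) (P.F.circ (nIn P n))).gates

/-- The quantum stage: for every `j < K n`, swap, copy, swap back ("loop `k` times on a machine
that runs `M`", BBBV step 3). [cite: BennettBernsteinBrassardVazirani1997, Thm. 4.13 (proof, step 3)] -/
def stageQ (n : ℕ) : List (QGate cliffordT (n + anc P n)) :=
  (List.range (K P n)).flatMap fun j => conjGates P n j ++ (copyGates P n ++ conjGates P n j)

/-- **The circuit of the `K(n)`-copy family on inputs of length `n`.** [cite: BennettBernsteinBrassardVazirani1997, Thm. 4.13 (proof)] -/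
def circ (n : ℕ) : QCircuit cliffordT (n + anc P n) := ⟨stage1 P n ++ stageQ P n⟩

/-- **The `K(n)`-copy family.** [cite: BennettBernsteinBrassardVazirani1997, Thm. 4.13 (k independent copies of M)] -/
def family : QCircuitFamily cliffordT := ⟨anc P, circ P⟩

/-- The circuit of the family (definitional). [folklore] -/
@[simp] theorem family_circ (n : ℕ) : (family P).circ n = circ P n := rfl

/-- The ancillas of the family (definitional). [folklore] -/
@[simp] theorem family_ancillas (n : ℕ) : (family P).ancillas n = anc P n := rfl

/-- **The family is oracle-free** (if the given one is). [folklore] -/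
theorem family_isOracleFree (hF : P.F.IsOracleFree) : (family P).IsOracleFree := by
  intro n g hg
  have hg' : g ∈ stage1 P n ++ stageQ P n := hg
  rcases List.mem_append.1 hg' with h | h
  · exact revCompile_isOracleFree (clamp P n (prog1 P n) (prog1_lt' n) (prog1_wf n)) g h
  · obtain ⟨j, -, h⟩ := List.mem_flatMap.1 h
    have hconj : g ∈ conjGates P n j → g.IsOracleFree := fun h => by
      unfold conjGates at h
      split_ifs at h with hj
      · exact revCompile_isOracleFree (clamp P n (progConj P n j) (progConj_lt' hj) (progConj_wf n j)) g h
      · exact absurd h List.not_mem_nil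
    rcases List.mem_append.1 h with h | h
    · exact hconj h
    rcases List.mem_append.1 h with h | h
    · exact isOracleFree_mapWires _ (hF (nIn P n)) g h
    · exact hconj h

end Compile

/-! ### Stage 1 on the input -/

section Stage1Matrix

/-- The basis label after stage 1 on the input `x`. [folklore] -/
def W1 (x : List Bool) : QReg (x.length + anc P x.length) := fun p => w1 P x p

variable {P}

/-- **Stage 1 on a basis state.** [cite: AroraBarak2009, §10.3.7 Lemma 10.10] -/
theorem toMatrix_stage1_mulVec_basisState (A : Language Bool) (n : ℕ) (w : QReg (n + anc P n)) :
    (⟨stage1 P n⟩ : QCircuit cliffordT (n + anc P n)).toMatrix A *ᵥ basisState w =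
      basisState (fun p => clEval (prog1 P n) (liftW w) p) := by
  rw [stage1, revCompile_mulVec_basisState]
  congr 1
  funext p
  exact revEval_clamp P n _ _ _ w p

/-- **Stage 1 on the input `|x 0…0⟩` yields `|w1 x⟩`.** [cite: AroraBarak2009, §10.3.7 Lemma 10.10] -/
theorem toMatrix_stage1_mulVec_pad (A : Language Bool) (x : List Bool) :
    (⟨stage1 P x.length⟩ : QCircuit cliffordT (x.length + anc P x.length)).toMatrix A *ᵥ
        basisState (padInput x.get (anc P x.length)) = basisState (W1 P x) := by
  rw [toMatrix_stage1_mulVec_basisState, PostBQPAmp.liftW_padInput_get]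
  rfl

end Stage1Matrix

/-! ### The conjugating swap -/

section Conj

variable {P} {n j : ℕ} (hj : j < K P n)

include hj in
/-- Block wires fit. [folklore] -/
theorem blk_fits {i : ℕ} (hi : i < b P n) : blk P n j i < n + anc P n := by
  rw [n_add_anc]; exact blk_lt_W hj hi

/-- **The wire involution of the conjugating swap**: front wire `i < b n` ↔ wire `i` of block `j`,
all other wires fixed. [cite: NielsenChuang2010, §1.3.4 (swap from three CNOTs)] -/
def conjInvol (hj : j < K P n) (p : Fin (n + anc P n)) : Fin (n + anc P n) :=
  if h1 : (p : ℕ) < b P n then ⟨blk P n j p, blk_fits hj h1⟩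
  else if h2 : blk P n j 0 ≤ p ∧ (p : ℕ) < blk P n j 0 + b P n then
    ⟨p - blk P n j 0, by have := p.isLt; omega⟩
  else p

/-- `conjInvol` on a front wire. [folklore] -/
theorem conjInvol_of_lt {p : Fin (n + anc P n)} (hp : (p : ℕ) < b P n) : (conjInvol hj p : ℕ) = blk P n j p := by
  unfold conjInvol; rw [dif_pos hp]

/-- `conjInvol` on a block wire. [folklore] -/
theorem conjInvol_blk {i : ℕ} (hi : i < b P n) : (conjInvol hj ⟨blk P n j i, blk_fits hj hi⟩ : ℕ) = i := by
  have h1 : ¬ blk P n j i < b P n := Nat.not_lt.2 ((b_lt_base n).le.trans (base_le_blk n j i))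
  have h2 : blk P n j 0 ≤ blk P n j i ∧ blk P n j i < blk P n j 0 + b P n := by rw [blk_eq_add n j i]; omega
  unfold conjInvol
  rw [dif_neg h1, dif_pos h2]
  simp [blk_eq_add n j i]

/-- `conjInvol` elsewhere. [folklore] -/
theorem conjInvol_of_not {p : Fin (n + anc P n)} (hp : ¬ (p : ℕ) < b P n)
    (hp' : ¬ (blk P n j 0 ≤ p ∧ (p : ℕ) < blk P n j 0 + b P n)) : conjInvol hj p = p := by
  unfold conjInvol; rw [dif_neg hp, dif_neg hp']

/-- **`conjInvol` is an involution.** [folklore] -/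
theorem conjInvol_conjInvol (p : Fin (n + anc P n)) : conjInvol hj (conjInvol hj p) = p := by
  have hb := (b_lt_base (P := P) n).le.trans (base_le_blk n j 0)
  by_cases h1 : (p : ℕ) < b P n
  · have e : conjInvol hj p = ⟨blk P n j p, blk_fits hj h1⟩ := by unfold conjInvol; rw [dif_pos h1]
    rw [e]
    exact Fin.ext (conjInvol_blk hj h1)
  · by_cases h2 : blk P n j 0 ≤ p ∧ (p : ℕ) < blk P n j 0 + b P n
    · have hi : (p : ℕ) - blk P n j 0 < b P n := by omega
      have e : conjInvol hj p = ⟨p - blk P n j 0, by have := p.isLt; omega⟩ := by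
        unfold conjInvol; rw [dif_neg h1, dif_pos h2]
      rw [e]
      apply Fin.ext
      rw [conjInvol_of_lt hj (by exact hi)]
      simp only
      rw [blk_eq_add n j]; omega
    · rw [conjInvol_of_not hj h1 h2, conjInvol_of_not hj h1 h2]

/-- **The compiled conjugating swap permutes basis states along `conjInvol`.** [cite: NielsenChuang2010, §1.3.4 (swap from three CNOTs)] -/
theorem toMatrix_conjGates_mulVec_basisState (A : Language Bool) (w : QReg (n + anc P n)) :
    (⟨conjGates P n j⟩ : QCircuit cliffordT (n + anc P n)).toMatrix A *ᵥ basisState w = basisState (w ∘ conjInvol hj) := by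
  unfold conjGates
  rw [dif_pos hj, revCompile_mulVec_basisState]
  congr 1
  funext p
  rw [revEval_clamp]
  unfold progConj
  have hb := (b_lt_base (P := P) n).le.trans (base_le_blk n j 0)
  have h1 : ((conjPairs P n j).map Prod.fst).Nodup := by
    rw [conjPairs, List.map_map]; simpa [Function.comp_def] using List.nodup_range
  have h2 : ((conjPairs P n j).map Prod.snd).Nodup := by
    rw [conjPairs, List.map_map]
    exact List.nodup_range.map_on fun a _ c _ h => by simp only [Function.comp_apply] at h; unfold blk at h; omega
  have h12 : ∀ q ∈ conjPairs P n j, ∀ q' ∈ conjPairs P n j, q.1 ≠ q'.2 := by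
    intro q hq q' hq'
    simp only [conjPairs, List.mem_map, List.mem_range] at hq hq'
    obtain ⟨i, hi, rfl⟩ := hq; obtain ⟨i', -, rfl⟩ := hq'
    exact Nat.ne_of_lt (lt_of_lt_of_le hi ((b_lt_base n).le.trans (base_le_blk n j i')))
  obtain ⟨hsnd, hfst, hother⟩ := clEval_swapOps (conjPairs P n j) h1 h2 h12 (liftW w)
  simp only [Function.comp_apply]
  by_cases hp : (p : ℕ) < b P n
  · have hmem : ((p : ℕ), blk P n j p) ∈ conjPairs P n j := List.mem_map.2 ⟨p, List.mem_range.2 hp, rfl⟩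
    rw [hfst _ hmem]
    change liftW w (blk P n j p) = w (conjInvol hj p)
    rw [← liftW_val w (conjInvol hj p), conjInvol_of_lt hj hp]
  · by_cases hp2 : blk P n j 0 ≤ p ∧ (p : ℕ) < blk P n j 0 + b P n
    · have hi : (p : ℕ) - blk P n j 0 < b P n := by omega
      have hpe : (p : ℕ) = blk P n j (p - blk P n j 0) := by rw [blk_eq_add n j]; omega
      have hmem : ((p : ℕ) - blk P n j 0, (p : ℕ)) ∈ conjPairs P n j :=
        List.mem_map.2 ⟨_, List.mem_range.2 hi, by rw [← hpe]⟩
      rw [hsnd _ hmem]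
      change liftW w ((p : ℕ) - blk P n j 0) = w (conjInvol hj p)
      rw [← liftW_val w (conjInvol hj p)]
      congr 1
      unfold conjInvol; rw [dif_neg hp, dif_pos hp2]
    · rw [hother _ (fun q hq => ?_), conjInvol_of_not hj hp hp2, liftW_val]
      simp only [conjPairs, List.mem_map, List.mem_range] at hq
      obtain ⟨i, hi, rfl⟩ := hq
      refine ⟨fun h => hp (h ▸ hi), fun h => hp2 ?_⟩
      rw [h, blk_eq_add n j i]; omega

/-- **Swap–copy–swap computes the copy transported along `conjInvol`.** [cite: NielsenChuang2010, §4.3 (a gate on a subset of the wires is U ⊗ 1 up to the order of the factors)] -/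
theorem toMatrix_conjBlock (A : Language Bool) :
    (⟨conjGates P n j ++ (copyGates P n ++ conjGates P n j)⟩ : QCircuit cliffordT (n + anc P n)).toMatrix A =
      (mapWires ((Fin.castLEEmb (copy_fits' n)).trans (invEmb (conjInvol hj) (conjInvol_conjInvol hj))) (P.F.circ (nIn P n))).toMatrix A :=
  toMatrix_conj_mapWires A (conjInvol hj) (conjInvol_conjInvol hj) (conjGates P n j)
    (toMatrix_conjGates_mulVec_basisState hj A) (Fin.castLEEmb (copy_fits' n)) (P.F.circ (nIn P n))

end Conj

/-! ### The blocks and the quantum stage -/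

section Blocks

variable (n : ℕ)

/-- Block `j` as an embedding of `b n` wires. [folklore] -/
def blockEmb (j : Fin (K P n)) : Fin (b P n) ↪ Fin (n + anc P n) :=
  ⟨fun i => ⟨blk P n j i, blk_fits j.isLt i.isLt⟩, fun _ _ h => Fin.ext (blk_inj (P := P) (Fin.isLt _) (Fin.isLt _) (congrArg Fin.val h)).2⟩

/-- The copy, padded to the block width. [folklore] -/
def Cpad : QCircuit cliffordT (b P n) := mapWires (Fin.castLEEmb (copy_fits n)) (P.F.circ (nIn P n))

variable {P n}

/-- `blockEmb` evaluated. [folklore] -/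
@[simp] theorem blockEmb_apply_val (j : Fin (K P n)) (i : Fin (b P n)) : (blockEmb P n j i : ℕ) = blk P n j i := rfl

/-- **The blocks are pairwise disjoint.** [folklore] -/
theorem blockDisjoint : BlockDisjoint (blockEmb P n) := by
  intro j j' hne
  refine Set.disjoint_left.2 ?_
  rintro w ⟨i, rfl⟩ ⟨i', hi'⟩
  have h := congrArg Fin.val hi'
  simp only [blockEmb_apply_val] at h
  exact hne (Fin.ext (blk_inj i'.isLt i.isLt h).1).symm

/-- Off the blocks means below `base`. [folklore] -/
theorem offBlocks_iff (w : Fin (n + anc P n)) : OffBlocks (blockEmb P n) w ↔ (w : ℕ) < base P n := by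
  constructor
  · intro h
    by_contra hlt
    push Not at hlt
    have hB : 0 < b P n := b_pos n
    have hw : (w : ℕ) < W P n := by rw [← n_add_anc]; exact w.isLt
    set d := (w : ℕ) - base P n with hd
    have hdlt : d < K P n * b P n := by unfold W at hw; omega
    have hjlt : d / b P n < K P n := (Nat.div_lt_iff_lt_mul hB).2 hdlt
    have hilt : d % b P n < b P n := Nat.mod_lt _ hB
    refine h ⟨d / b P n, hjlt⟩ ⟨⟨d % b P n, hilt⟩, Fin.ext ?_⟩
    simp only [blockEmb_apply_val]
    unfold blk
    have := Nat.div_add_mod d (b P n)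
    rw [Nat.mul_comm] at this
    omega
  · rintro hw j ⟨i, rfl⟩
    exact absurd (base_le_blk (P := P) n j i) (Nat.not_le.2 hw)

/-- Swap–copy–swap of block `j` is the padded copy embedded on block `j`, matrix-wise. [folklore] -/
theorem toMatrix_conjBlock_eq (A : Language Bool) (j : Fin (K P n)) :
    (⟨conjGates P n j ++ (copyGates P n ++ conjGates P n j)⟩ : QCircuit cliffordT (n + anc P n)).toMatrix A =
      (mapWires (blockEmb P n j) (Cpad P n)).toMatrix A := by
  rw [toMatrix_conjBlock j.isLt, toMatrix_mapWires, Cpad, toMatrix_mapWires, toMatrix_mapWires, placeGate_placeGate]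
  congr 1
  ext i
  simp only [Function.Embedding.trans_apply, Fin.castLEEmb_apply, blockEmb_apply_val, Fin.val_castLE, invEmb_apply]
  exact conjInvol_of_lt j.isLt (lt_of_lt_of_le i.isLt (copy_fits n))

/-- **The quantum stage is the product of the padded copies on the blocks, matrix-wise.**
[cite: NielsenChuang2010, §4.3 (a gate on a subset of the wires is U ⊗ 1 up to the order of the factors)] -/
theorem toMatrix_stageQ (A : Language Bool) :
    (⟨stageQ P n⟩ : QCircuit cliffordT (n + anc P n)).toMatrix A =
      (⟨(List.finRange (K P n)).flatMap fun j => (mapWires (blockEmb P n j) (Cpad P n)).gates⟩ :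
        QCircuit cliffordT (n + anc P n)).toMatrix A := by
  have hl : stageQ P n = (List.finRange (K P n)).flatMap fun j : Fin _ =>
      conjGates P n j ++ (copyGates P n ++ conjGates P n j) := by
    rw [stageQ, ← List.map_coe_finRange_eq_range, List.flatMap_map]
  rw [hl]
  exact toMatrix_flatMap_congr A _ _ _ fun j _ => toMatrix_conjBlock_eq A j

variable (P) (x : List Bool)

/-- **The input of copy `j`**: `x ++ e_j` as a register of length `nIn |x|` (data bits, then the
one-hot index). [cite: BennettBernsteinBrassardVazirani1997, Thm. 4.14 (proof: inputs of the calls)] -/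
def inIdx (j : ℕ) : QReg (nIn P x.length) := fun p =>
  if h : (p : ℕ) < x.length then x.get ⟨p, h⟩ else decide ((p : ℕ) = x.length + j)

/-- `x ++ e_j` as a bit string. [folklore] -/
def inputIdx (j : ℕ) : List Bool := x ++ List.ofFn fun j' : Fin (K P x.length) => decide ((j' : ℕ) = j)

/-- The input of copy `j`, padded to the block width: `x ++ e_j`, `0^{F.ancillas (nIn |x|)}`, zeros. [folklore] -/
def padBlock (j : ℕ) : QReg (b P x.length) :=
  padInput (padInput (inIdx P x j) (P.F.ancillas (nIn P x.length)))
      (b P x.length - (nIn P x.length + P.F.ancillas (nIn P x.length))) ∘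
    Fin.cast (Nat.add_sub_cancel' (copy_fits x.length)).symm

/-- **The block state of copy `j`** after the quantum stage. [folklore] -/
def blockState (j : ℕ) : QReg (b P x.length) → ℂ := (Cpad P x.length).toMatrix 0 *ᵥ basisState (padBlock P x j)

variable {P x}

/-- The length of `x ++ e_j` is `nIn |x|`. [folklore] -/
@[simp] theorem length_inputIdx (j : ℕ) : (inputIdx P x j).length = nIn P x.length := by
  simp [inputIdx, nIn]

/-- `x ++ e_j` read as a register is `inIdx x j`. [folklore] -/
theorem get_inputIdx (j : ℕ) (p : Fin (inputIdx P x j).length) :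
    (inputIdx P x j).get p = inIdx P x j (Fin.cast (length_inputIdx j) p) := by
  obtain ⟨p, hp⟩ := p
  have hp' : p < nIn P x.length := by rwa [length_inputIdx] at hp
  unfold inIdx
  simp only [Fin.cast_mk, List.get_eq_getElem]
  simp only [inputIdx] at hp ⊢
  by_cases h : p < x.length
  · rw [dif_pos h, List.getElem_append_left h]
  · rw [dif_neg h, List.getElem_append_right (Nat.not_lt.1 h), List.getElem_ofFn]
    change decide (p - x.length = j) = decide (p = x.length + j)
    congr 1
    exact propext ⟨fun e => by omega, fun e => by omega⟩

/-- `padBlock` on a data wire. [folklore] -/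
theorem padBlock_of_lt (j : ℕ) (i : Fin (b P x.length)) (hi : (i : ℕ) < x.length) : padBlock P x j i = x.get ⟨i, hi⟩ := by
  have hi' : (i : ℕ) < nIn P x.length := lt_of_lt_of_le hi (le_nIn _)
  have e1 : Fin.cast (Nat.add_sub_cancel' (copy_fits x.length)).symm i =
      Fin.castAdd (b P x.length - (nIn P x.length + P.F.ancillas (nIn P x.length)))
        (Fin.castAdd (P.F.ancillas (nIn P x.length)) ⟨i, hi'⟩) := Fin.ext rfl
  simp only [padBlock, Function.comp_apply]
  rw [e1, padInput, Fin.append_left, padInput, Fin.append_left]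
  unfold inIdx; rw [dif_pos hi]

/-- `padBlock` on an index wire: wire `|x| + j'` of copy `j` is `[j' = j]`. [folklore] -/
theorem padBlock_idx (j : ℕ) (i : Fin (b P x.length)) (hi : x.length ≤ (i : ℕ)) (hi' : (i : ℕ) < nIn P x.length) :
    padBlock P x j i = decide ((i : ℕ) = x.length + j) := by
  have e1 : Fin.cast (Nat.add_sub_cancel' (copy_fits x.length)).symm i =
      Fin.castAdd (b P x.length - (nIn P x.length + P.F.ancillas (nIn P x.length)))
        (Fin.castAdd (P.F.ancillas (nIn P x.length)) ⟨i, hi'⟩) := Fin.ext rfl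
  simp only [padBlock, Function.comp_apply]
  rw [e1, padInput, Fin.append_left, padInput, Fin.append_left]
  unfold inIdx; rw [dif_neg (Nat.not_lt.2 hi)]

/-- `padBlock` beyond the input wires of the copy is `0`. [folklore] -/
theorem padBlock_of_le (j : ℕ) (i : Fin (b P x.length)) (hi : nIn P x.length ≤ (i : ℕ)) : padBlock P x j i = false := by
  simp only [padBlock, Function.comp_apply]
  by_cases hi2 : (i : ℕ) < nIn P x.length + P.F.ancillas (nIn P x.length)
  · have e1 : Fin.cast (Nat.add_sub_cancel' (copy_fits x.length)).symm i =
        Fin.castAdd (b P x.length - (nIn P x.length + P.F.ancillas (nIn P x.length)))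
          (Fin.natAdd (nIn P x.length) ⟨i - nIn P x.length, by omega⟩) := Fin.ext (by simp; omega)
    rw [e1, padInput, Fin.append_left, padInput, Fin.append_right]
  · have e1 : Fin.cast (Nat.add_sub_cancel' (copy_fits x.length)).symm i =
        Fin.natAdd (nIn P x.length + P.F.ancillas (nIn P x.length))
          ⟨i - (nIn P x.length + P.F.ancillas (nIn P x.length)), by have := i.isLt; omega⟩ :=
      Fin.ext (by simp; omega)
    rw [e1, padInput, Fin.append_right]

/-- Restricting `padBlock` to the copy gives the padded input of the copy. [folklore] -/
theorem padBlock_comp_castLE (j : ℕ) :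
    padBlock P x j ∘ Fin.castLEEmb (copy_fits x.length) = padInput (inIdx P x j) (P.F.ancillas (nIn P x.length)) := by
  funext i
  simp only [Function.comp_apply]
  by_cases hi : (i : ℕ) < nIn P x.length
  · have e : i = Fin.castAdd (P.F.ancillas (nIn P x.length)) ⟨i, hi⟩ := Fin.ext rfl
    conv_rhs => rw [e, padInput, Fin.append_left]
    by_cases hix : (i : ℕ) < x.length
    · rw [padBlock_of_lt j _ (by exact hix)]
      unfold inIdx; rw [dif_pos (by exact hix)]
      rfl
    · rw [padBlock_idx j _ (by exact Nat.not_lt.1 hix) (by exact hi)]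
      unfold inIdx; rw [dif_neg (by exact hix)]
      rfl
  · rw [padBlock_of_le j _ (by exact Nat.not_lt.1 hi)]
    have e : i = Fin.natAdd (nIn P x.length) ⟨i - nIn P x.length, by have := i.isLt; omega⟩ := Fin.ext (by simp; omega)
    conv_rhs => rw [e, padInput, Fin.append_right]

/-- **The content of block `j` after stage 1 is the padded input of copy `j`.** [folklore] -/
theorem W1_comp_blockEmb (j : Fin (K P x.length)) : W1 P x ∘ blockEmb P x.length j = padBlock P x j := by
  funext i
  simp only [Function.comp_apply, W1]
  change w1 P x (blk P x.length j i) = _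
  by_cases hi : (i : ℕ) < x.length
  · rw [w1_blk_of_lt x j.isLt hi, padBlock_of_lt j i hi, List.getD_eq_getElem _ _ hi]
    rfl
  · by_cases hi' : (i : ℕ) < nIn P x.length
    · have hj' : (i : ℕ) - x.length < K P x.length := by unfold nIn at hi'; omega
      have e : (i : ℕ) = x.length + ((i : ℕ) - x.length) := by omega
      rw [padBlock_idx j i (Nat.not_lt.1 hi) hi']
      conv_lhs => rw [e]
      rw [w1_blk_idx x j.isLt hj']
      congr 1
      exact propext ⟨fun h => by omega, fun h => by omega⟩
    · rw [w1_blk_of_le x j.isLt (Nat.not_lt.1 hi') i.isLt, padBlock_of_le j i (Nat.not_lt.1 hi')]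

/-- **The state after the quantum stage is the product state of the block states** (off the blocks:
`w1 x`). [cite: NielsenChuang2010, §2.1.7 eq. (2.45)] -/
theorem stageQ_mulVec_W1 :
    (⟨stageQ P x.length⟩ : QCircuit cliffordT (x.length + anc P x.length)).toMatrix 0 *ᵥ basisState (W1 P x) =
      prodState (blockEmb P x.length) (fun j => blockState P x j) (W1 P x) := by
  rw [toMatrix_stageQ, basisState_eq_prodState (blockEmb P x.length) (W1 P x),
    toMatrix_flatMap_mapWires_mulVec_prodState 0 blockDisjoint]
  congr 1
  funext j
  rw [W1_comp_blockEmb j]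
  rfl

/-- **The final state is the product state.** [folklore] -/
theorem runOn_circ (x : List Bool) :
    (circ P x.length).runOn 0 (basisState (padInput x.get (anc P x.length))) =
      prodState (blockEmb P x.length) (fun j => blockState P x j) (W1 P x) := by
  rw [QCircuit.runOn, circ, show (⟨stage1 P x.length ++ stageQ P x.length⟩ : QCircuit cliffordT (x.length + anc P x.length)) =
      (⟨stage1 P x.length⟩ : QCircuit cliffordT _).append ⟨stageQ P x.length⟩ from rfl, QCircuit.toMatrix_append,
    ← Matrix.mulVec_mulVec, toMatrix_stage1_mulVec_pad, stageQ_mulVec_W1]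

end Blocks

/-! ## Part III. The output kernel -/

section Law

variable {P}

/-- **The output kernel of the indexed-copies family is the Born sum of the product state.**
[cite: NielsenChuang2010, §2.2.5 (Born rule)] -/
theorem kernelProb_family_eq (x : List Bool) (E : Set (List Bool)) [DecidablePred (· ∈ E)] :
    (family P).kernelProb 0 x E = ∑ z : QReg (x.length + anc P x.length),
      if List.ofFn z ∈ E then ‖prodState (blockEmb P x.length) (fun j => blockState P x j) (W1 P x) z‖ ^ 2 else 0 := by
  change ((((circ P x.length).outputPMF 0 x.get).map List.ofFn).toOuterMeasure E).toReal = _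
  rw [toReal_outputPMF_map_ofFn, runOn_circ]

/-- **Every block state is a unit vector.** [cite: NielsenChuang2010, §2.2.5 (normalisation)] -/
theorem sum_normSq_blockState (x : List Bool) (j : ℕ) : ∑ v, ‖blockState P x j v‖ ^ 2 = 1 := by
  have h := normSq_mulVec_of_mem_unitaryGroup
    (QCircuit.toMatrix_mem_unitaryGroup_holds cliffordT_isUnitary_holds 0 (Cpad P x.length)) (basisState (padBlock P x j))
  rw [normSq_basisState] at h
  exact h

/-- **The weight that block `j` gives to an event of the copy's wires is the probability of that
event under the given family on the input `x ++ e_j`** (one-block marginal; the event is read on the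
`nIn |x| + F.ancillas (nIn |x|)` wires of the copy). [cite: NielsenChuang2010, §2.2.8 (measurement of one register of a product state)] -/
theorem sum_ite_normSq_blockState (x : List Bool) (j : ℕ)
    (T : QReg (nIn P x.length + P.F.ancillas (nIn P x.length)) → Prop) [DecidablePred T] :
    (∑ v : QReg (b P x.length), if T (v ∘ Fin.castLEEmb (copy_fits x.length)) then ‖blockState P x j v‖ ^ 2 else 0) =
      ∑ u : QReg (nIn P x.length + P.F.ancillas (nIn P x.length)),
        if T u then ‖((P.F.circ (nIn P x.length)).runOn 0 (basisState (padInput (inIdx P x j) (P.F.ancillas (nIn P x.length))))) u‖ ^ 2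
        else 0 := by
  simp only [blockState, Cpad, toMatrix_mapWires]
  rw [sum_normSq_placeGate_castLE (copy_fits x.length) ((P.F.circ (nIn P x.length)).toMatrix 0) (padBlock P x j) T,
    padBlock_comp_castLE]
  refine Finset.sum_congr rfl fun u _ => ?_
  simp only [QCircuit.runOn, mulVec_basisState]

end Law

end PolyCopiesIdx

end Literature.Computability.QuantumComplexity

end
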